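import Literature.AlgebraicGeometry.Motives.ComparisonProofs
import Literature.AlgebraicGeometry.Motives.Correspondences
import HarnessLib

/-!
# Comparison of Weil cohomology theories: invariance of the standard conjecture `D(X)` (proofs)

For two Weil cohomology theories `W₁` (coefficients `K₁`) and `W₂` (coefficients `K₂`) compared
over a common overfield `L` by a `Literature.AlgebraicGeometry.Motives.WeilComparison` (functorial
`L`-linear isomorphisms `L ⊗_{K₁} H₁ⁱ(X) ≅ L ⊗_{K₂} H₂ⁱ(X)` compatible with cup products, traces
and cycle classes; Deligne–Milne 1982, I §1), Grothendieck's standard conjecture `D(X)`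
(Kleiman 1968, §3: homological equivalence equals numerical equivalence on the smooth projective
`X`, i.e. the cup-product pairing `Aᵖ(X)_ℚ × A^{n-p}(X)_ℚ → K` has trivial left kernel,
`WeilCohomology.StandardConjectureD`) holds for `W₁` iff it holds for `W₂`
(`WeilComparison.standardConjectureD_iff_holds`); consequently the standard conjecture `D` for
all smooth projective varieties (`WeilCohomology.HomNumStandardConjecture`) holds for `W₁` iff it
holds for `W₂` (`WeilComparison.homNumStandardConjecture_iff_of_comparison`). Both are proved here
(transport of structure), reusing the helper `one_tmul_injective` of the companion file
`Literature.AlgebraicGeometry.Motives.ComparisonProofs` (invariance of homological triviality,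
`isHomologicallyTrivial_iff_holds`).

## Why the invariance statements live in this file (import hygiene, 2026-08-15)

The two statements mention the standard conjectures `D(X)` / `D`, which are OPEN CONJECTURES
declared in `Literature.AlgebraicGeometry.Motives.Correspondences`. They are therefore kept here,
one level above the vocabulary file `Literature.AlgebraicGeometry.Motives.Comparison`
(comparison data, periods, period matrices and fields), so that `Comparison` — and with it the
period vocabulary built on it (`PeriodComparison`, `RelativePeriods`, and the Kontsevich–Zagier
files under `Literature.NumberTheory.Transcendental`) — need not import the open standard
conjectures. The single-variety statement `standardConjectureD_iff_holds` was originally the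
discharge of a named fact of `Comparison` with literally this statement; it keeps its name and
statement (now written with explicit binders `C`, `hX`). The all-varieties corollary is stated
unconditionally (`homNumStandardConjecture_iff_of_comparison`), superseding the conditional
formulation that took the single-variety invariance as a hypothesis.

## Proof (transport of structure; Kleiman 1968 §3 with Deligne–Milne 1982, I §1)

Write `ι = iso_X : L ⊗_{K₁} H₁^{2p}(X) ⥲ L ⊗_{K₂} H₂^{2p}(X)` and `j_r(x) = 1 ⊗ x`
(`r = 1, 2`); `j_r` is injective because `K_r` is a field (`one_tmul_injective`).

1. By closure induction on the generators `cl(Z)` (axiom `iso_cycleClass`: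
   `ι (j₁ (cl₁ Z)) = j₂ (cl₂ Z)` for prime cycles `Z` of codimension `p`), `ι` carries
   `j₁(Aᵖ(X))` into `j₂(Aᵖ(X))` (`exists_mem_algebraicLattice_iso_tmul`) and, dividing by the
   denominator in the characteristic-zero field `K₂`, `j₁(Aᵖ(X)_ℚ)` into `j₂(Aᵖ(X)_ℚ)`
   (`exists_mem_ratAlgebraicClasses_iso_tmul`); the symmetric comparison `C.symm` gives the
   reverse inclusion.
2. If `ι (j₁ x) = j₂ x'` and `ι (j₁ y) = j₂ y'` then `tr₁(x ∪ y) = tr₂(x' ∪ y')` in `L`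
   (`algebraMap_cupPairing_eq`, from the axioms `iso_cup` and `iso_trace`).
3. Assume `D(X)` for `W₂` and let `x ∈ Aᵖ(X)_ℚ ⊆ H₁^{2p}(X)` pair to zero with `A^q(X)_ℚ`,
   `p + q = dim X`. Pick `x'` with `ι (j₁ x) = j₂ x'` (step 1); every `y' ∈ A^q(X)_ℚ ⊆ H₂^{2q}(X)`
   satisfies `j₂ y' = ι (j₁ y)` for some `y ∈ A^q(X)_ℚ ⊆ H₁^{2q}(X)` (step 1 for `C.symm`), so by
   step 2 and the injectivity of `K₂ → L` the class `x'` pairs to zero with `A^q(X)_ℚ`, whence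
   `x' = 0`, `ι (j₁ x) = 0` and `x = 0` (`standardConjectureD_of_standardConjectureD`). The
   converse is the same statement for `C.symm` (`standardConjectureD_iff_holds`); quantifying
   over all smooth projective `X` gives `homNumStandardConjecture_iff_of_comparison`.

## References

* S. Kleiman, *Algebraic cycles and the Weil conjectures*, in: Dix exposés sur la cohomologie
  des schémas, North-Holland (1968), 359–386, §3 (conjecture `D(X)`). [Kleiman1968]
* P. Deligne, J. Milne, *Tannakian categories*, in LNM 900 (1982), I §1 (comparison
  isomorphisms compatible with cup products, traces and cycle maps). [DeligneMilne1982]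
-/
universe u v w w'

open CategoryTheory AlgebraicGeometry
open scoped TensorProduct

noncomputable section

namespace Literature.AlgebraicGeometry.Motives

namespace WeilComparison

/-! ### Transport of algebraic classes and pairings along a comparison -/

section Transport

variable {k : Type u} [Field k] {K₁ : Type v} {K₂ : Type w} [Field K₁] [Field K₂]
  {W₁ : PreWeilCohomology k K₁} {W₂ : PreWeilCohomology k K₂} {L : Type w'} [Field L]
  [Algebra K₁ L] [Algebra K₂ L] (C : WeilComparison W₁ W₂ L) {n : ℕ} {X : SchemeOver k}

/-- `1 ⊗ (N • v) = N • (1 ⊗ v)` in `L ⊗_K V` for an integer `N` (scalar extension of the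
`K`-action to `L`). [folklore] -/
lemma one_tmul_intCast_smul (K : Type*) (L : Type*) [Field K] [Field L] [Algebra K L]
    {V : Type*} [AddCommGroup V] [Module K V] (N : ℤ) (v : V) :
    (1 : L) ⊗ₜ[K] (N • v) = (N : L) • ((1 : L) ⊗ₜ[K] v) := by
  rw [← Int.cast_smul_eq_zsmul K, TensorProduct.tmul_smul, ← algebraMap_smul L (N : K),
    map_intCast]

/-- `1 ⊗ (N⁻¹ • v) = N⁻¹ • (1 ⊗ v)` in `L ⊗_K V` for an integer `N` (scalar extension of the
`K`-action to `L`). [folklore] -/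
lemma one_tmul_inv_intCast_smul (K : Type*) (L : Type*) [Field K] [Field L] [Algebra K L]
    {V : Type*} [AddCommGroup V] [Module K V] (N : ℤ) (v : V) :
    (1 : L) ⊗ₜ[K] ((N : K)⁻¹ • v) = ((N : L))⁻¹ • ((1 : L) ⊗ₜ[K] v) := by
  rw [TensorProduct.tmul_smul, ← algebraMap_smul L ((N : K)⁻¹), map_inv₀, map_intCast]

/-- The comparison carries the algebraic lattice of `W₁` into that of `W₂`: for `x ∈ Aᵖ(X)`
(inside `H₁^{2p}(X)`) there is `x' ∈ Aᵖ(X)` (inside `H₂^{2p}(X)`) with `iso (1 ⊗ x) = 1 ⊗ x'`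
(closure induction on the generators `cl(Z)`, using `iso_cycleClass`; Deligne–Milne 1982, I §1).
[cite: DeligneMilne1982, I §1] -/
theorem exists_mem_algebraicLattice_iso_tmul (hX : IsSmoothProjective n X) (p : ℕ)
    {x : W₁.obj X (2 * p)} (hx : x ∈ W₁.algebraicLattice X p) :
    ∃ x' ∈ W₂.algebraicLattice X p,
      C.iso X (2 * p) ((1 : L) ⊗ₜ[K₁] x) = (1 : L) ⊗ₜ[K₂] x' := by
  induction hx using AddSubgroup.closure_induction with
  | mem y hy =>
    obtain ⟨⟨z, hz⟩, rfl⟩ := hy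
    exact ⟨W₂.cycleClass X p z, W₂.cycleClass_mem_algebraicLattice X p hz,
      C.iso_cycleClass hX p z hz⟩
  | zero => exact ⟨0, zero_mem _, by simp⟩
  | add y y' _ _ hy hy' =>
    obtain ⟨u, hu, hyu⟩ := hy
    obtain ⟨u', hu', hyu'⟩ := hy'
    exact ⟨u + u', add_mem hu hu', by rw [TensorProduct.tmul_add, map_add, hyu, hyu',
      TensorProduct.tmul_add]⟩
  | neg y _ hy =>
    obtain ⟨u, hu, hyu⟩ := hy
    exact ⟨-u, neg_mem hu, by rw [TensorProduct.tmul_neg, map_neg, hyu, TensorProduct.tmul_neg]⟩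

/-- The comparison carries the rational algebraic classes of `W₁` into those of `W₂`: for
`x ∈ Aᵖ(X)_ℚ ⊆ H₁^{2p}(X)` there is `x' ∈ Aᵖ(X)_ℚ ⊆ H₂^{2p}(X)` with `iso (1 ⊗ x) = 1 ⊗ x'`
(from the lattice case, dividing by the denominator in the characteristic-zero field `K₂`;
Deligne–Milne 1982, I §1). [cite: DeligneMilne1982, I §1] -/
theorem exists_mem_ratAlgebraicClasses_iso_tmul [CharZero K₂] (hX : IsSmoothProjective n X)
    (p : ℕ) {x : W₁.obj X (2 * p)} (hx : x ∈ W₁.ratAlgebraicClasses X p) :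
    ∃ x' ∈ W₂.ratAlgebraicClasses X p,
      C.iso X (2 * p) ((1 : L) ⊗ₜ[K₁] x) = (1 : L) ⊗ₜ[K₂] x' := by
  obtain ⟨N, hN, hNx⟩ := hx
  obtain ⟨y, hy, hNy⟩ := C.exists_mem_algebraicLattice_iso_tmul hX p hNx
  have hNK₂ : (N : K₂) ≠ 0 := Int.cast_ne_zero.mpr hN
  have hNL : (N : L) ≠ 0 := by
    have h := (map_ne_zero (algebraMap K₂ L)).mpr hNK₂
    rwa [map_intCast] at h
  refine ⟨(N : K₂)⁻¹ • y, ⟨N, hN, ?_⟩, ?_⟩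
  · rwa [← Int.cast_smul_eq_zsmul K₂, smul_smul, mul_inv_cancel₀ hNK₂, one_smul]
  · rw [one_tmul_intCast_smul, map_smul] at hNy
    rw [one_tmul_inv_intCast_smul, ← hNy, smul_smul, inv_mul_cancel₀ hNL, one_smul]

/-- The comparison preserves the Poincaré duality pairings: if `iso (1 ⊗ x) = 1 ⊗ x'` and
`iso (1 ⊗ y) = 1 ⊗ y'` then `tr₁ (x ∪ y) = tr₂ (x' ∪ y')` in `L` (from `iso_cup` and
`iso_trace`; Deligne–Milne 1982, I §1: comparison isomorphisms are compatible with the algebra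
structures and the traces). [cite: DeligneMilne1982, I §1] -/
theorem algebraMap_cupPairing_eq (hX : IsSmoothProjective n X) {i j : ℕ} (h : i + j = 2 * n)
    {x : W₁.obj X i} {y : W₁.obj X j} {x' : W₂.obj X i} {y' : W₂.obj X j}
    (hx : C.iso X i ((1 : L) ⊗ₜ[K₁] x) = (1 : L) ⊗ₜ[K₂] x')
    (hy : C.iso X j ((1 : L) ⊗ₜ[K₁] y) = (1 : L) ⊗ₜ[K₂] y') :
    algebraMap K₁ L (W₁.cupPairing X n i j h x y) =
      algebraMap K₂ L (W₂.cupPairing X n i j h x' y') := by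
  have hcup : C.iso X (2 * n) ((1 : L) ⊗ₜ[K₁] W₁.cup h x y) = (1 : L) ⊗ₜ[K₂] W₂.cup h x' y' := by
    have := C.iso_cup hX h ((1 : L) ⊗ₜ[K₁] x) ((1 : L) ⊗ₜ[K₁] y)
    rwa [PreWeilCohomology.cupBaseChange_tmul, hx, hy, PreWeilCohomology.cupBaseChange_tmul,
      one_mul] at this
  have htr := C.iso_trace hX ((1 : L) ⊗ₜ[K₁] W₁.cup h x y)
  rw [hcup, Module.Dual.baseChange_apply_tmul, Module.Dual.baseChange_apply_tmul] at htr
  simp only [PreWeilCohomology.cupPairing, LinearMap.compr₂_apply, Algebra.algebraMap_eq_smul_one]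
  exact htr.symm

/-- `1 ⊗ v = 0 ↔ v = 0` in `L ⊗_K V` for a field extension `L / K` (`x ↦ 1 ⊗ x` is injective,
`one_tmul_injective`). [folklore] -/
lemma one_tmul_eq_zero_iff (K : Type*) (L : Type*) [Field K] [Field L] [Algebra K L]
    {V : Type*} [AddCommGroup V] [Module K V] (v : V) :
    (1 : L) ⊗ₜ[K] v = 0 ↔ v = 0 :=
  map_eq_zero_iff (TensorProduct.mk K L V 1) (one_tmul_injective K L V)

end Transport

/-! ### Comparison invariance of `D(X)` and of `D` -/

section Invariance

variable {k : Type u} [Field k] {K₁ : Type v} {K₂ : Type w} [Field K₁] [Field K₂]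
  [CharZero K₁] [CharZero K₂] {W₁ : WeilCohomology k K₁} {W₂ : WeilCohomology k K₂}
  {L : Type w'} [Field L] [Algebra K₁ L] [Algebra K₂ L] {n : ℕ} {X : SchemeOver k}

/-- One direction of the comparison invariance of `D(X)`: if `W₁` and `W₂` are compared over `L`
and `D(X)` holds for `W₂`, then `D(X)` holds for `W₁` (Kleiman 1968 §3 with Deligne–Milne 1982,
I §1: rational algebraic classes and the pairing `tr (x ∪ y)` on them are transported by the
comparison, and `K₂ → L`, `x ↦ 1 ⊗ x`, `iso` are injective). [cite: Kleiman1968, §3] -/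
theorem standardConjectureD_of_standardConjectureD
    (C : WeilComparison W₁.toPreWeilCohomology W₂.toPreWeilCohomology L)
    (hX : IsSmoothProjective n X) (hD : W₂.StandardConjectureD n X) :
    W₁.StandardConjectureD n X := by
  intro p q hpq x hx hx0
  obtain ⟨x', hx', hxx'⟩ := C.exists_mem_ratAlgebraicClasses_iso_tmul hX p hx
  have hx'0 : x' = 0 := by
    refine hD p q hpq x' hx' fun y' hy' ↦ ?_
    obtain ⟨y, hy, hyy'⟩ := C.symm.exists_mem_ratAlgebraicClasses_iso_tmul hX q hy'
    have hyy : C.iso X (2 * q) ((1 : L) ⊗ₜ[K₁] y) = (1 : L) ⊗ₜ[K₂] y' := by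
      rw [← hyy', symm_iso, C.iso_isoInv hX]
    have key := C.algebraMap_cupPairing_eq hX (by omega) hxx' hyy
    rw [hx0 y hy, map_zero] at key
    exact (map_eq_zero_iff _ (algebraMap K₂ L).injective).mp key.symm
  rw [hx'0, TensorProduct.tmul_zero,
    map_eq_zero_iff _ (C.bijective_iso hX (2 * p)).injective, one_tmul_eq_zero_iff] at hxx'
  exact hxx'

/-- **Comparison invariance of the standard conjecture `D(X)`**: if two Weil cohomology theories
`W₁`, `W₂` are compared over `L` by `C` (compatibly with cup products, traces and cycle classes),
then homological equivalence agrees with numerical equivalence for `W₁` on the smooth projective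
`X` of dimension `n` iff it does for `W₂` (Kleiman 1968 §3, conjecture `D(X)`; transport of
structure along the comparison, Deligne–Milne 1982, I §1; the converse direction is the direct one,
`standardConjectureD_of_standardConjectureD`, for the symmetric comparison `C.symm`). Originally
the discharge of the named fact of `Comparison` recording exactly this statement
(`∀ C, IsSmoothProjective n X → (D(X) for W₁ ↔ D(X) for W₂)`); name and statement are kept (the
statement is now written out instead of through the fact's name). [cite: Kleiman1968, §3] -/
theorem standardConjectureD_iff_holds :
    ∀ (_ : WeilComparison W₁.toPreWeilCohomology W₂.toPreWeilCohomology L), IsSmoothProjective n X →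
      (W₁.StandardConjectureD n X ↔ W₂.StandardConjectureD n X) :=
  fun C hX ↦ ⟨fun h ↦ standardConjectureD_of_standardConjectureD C.symm hX h,
    fun h ↦ standardConjectureD_of_standardConjectureD C hX h⟩

/-- **Comparison invariance of the standard conjecture `D`** (all smooth projective varieties):
if `W₁` and `W₂` are compared over `L` by `C`, then homological and numerical equivalence agree on
every smooth projective variety for `W₁` iff they do for `W₂`
(`WeilCohomology.HomNumStandardConjecture`), by the single-variety invariance
`standardConjectureD_iff_holds` at every dimension and variety (Kleiman 1968 §3 with Deligne–Milne
1982, I §1). Unconditional: the comparison `C` is the only hypothesis. [cite: Kleiman1968, §3] -/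
theorem homNumStandardConjecture_iff_of_comparison
    (C : WeilComparison W₁.toPreWeilCohomology W₂.toPreWeilCohomology L) :
    W₁.HomNumStandardConjecture ↔ W₂.HomNumStandardConjecture :=
  ⟨fun h _ _ hX ↦ (standardConjectureD_iff_holds C hX).mp (h hX),
    fun h _ _ hX ↦ (standardConjectureD_iff_holds C hX).mpr (h hX)⟩

end Invariance

end WeilComparison

end Literature.AlgebraicGeometry.Motives

end
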